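import Summits.SmoothPoincare4.SmoothPoincare4.Theses.EntropyRung
import Summits.SmoothPoincare4.SmoothPoincare4.Theorems.EntropyRungSubcylindricalExistenceConformalRealisation
import Summits.SmoothPoincare4.SmoothPoincare4.Theorems.EntropyRungSubcylindricalExistenceRoundClauseEuclidean
import Literature.Geometry.Riemannian.RoundSphereProofs
import Literature.Geometry.Riemannian.AubinYamabeSphereEuclidean
import HarnessLib

/-!
# Transport of the Euclidean `𝒲`-clause to the blown-up witness metric on `S⁴`
(stub `helper_sphereBlowupTransport`, witness helper 9 of line `green-blowup-conformal-entropy`,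
crux `EntropyRung.SubcylindricalExistence`, item stmt-SmoothPoincare4-10871)

On Mathlib's unit sphere `S⁴ = Metric.sphere (0 : EuclideanSpace ℝ (Fin 5)) 1` with the round
metric `g_S = roundMetric`, let `g = W² g_S` (`W > 0` smooth, hypothesis `hgval`),
`G x = (2/(1 − ⟪x,p⟫))/W x`, and let `σ = extChartAt (𝓡 4) (−p)` be the stereographic chart centred
at the antipode of `p` (source `⊇ {p}ᶜ`, height `⟪σ⁻¹ z, p⟫ = −(4 − ‖z‖²)/(4 + ‖z‖²)` — both
HYPOTHESES here). Assume the Euclidean `𝒲`-clause on `ℝ⁴` at level `L` (HYPOTHESIS): for `τ > 0`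
and `v ∈ C_c^∞(ℝ⁴)` with `∫ (4πτ)⁻² v² dz = 1`, `L ≤ ∫ [4τ‖∇v‖² − v² log v² − 4v²](4πτ)⁻² dz`.
Then the blow-up clause holds on `S⁴`: for `τ > 0` and smooth `w` vanishing near `p` with
`∫ (4πτ)⁻² w² G⁴ dV_g = 1`, `L ≤ ∫ [4τ G⁻² |∇w|²_g − w² log w² − 4w²] (4πτ)⁻² G⁴ dV_g`.

Proof (an exact transport, no inequality is lost): put `v = w ∘ σ⁻¹`; it is smooth
(`contMDiff_extChartAt_symm_sphere`) and compactly supported (`tsupport w` is compact and misses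
`p`, hence lies in the chart source, and `support v ⊆ σ '' tsupport w`). In the chart,
`dV_g = W⁴ dV_S` (`riemannianMeasure_eq_withDensity_of_conformal_sq_four`) and
`dV_S = Ω⁴ dz`, `Ω(z) = 4/(‖z‖²+4)` (`integral_roundMetric_eq_integral_chart`), while the chart
hypothesis gives `2/(1 − ⟪σ⁻¹ z, p⟫) = (‖z‖²+4)/4 = Ω(z)⁻¹`; moreover `|∇w|²_g = W⁻² |∇w|²_S`
(`ConformalRealisation.gradSq_of_conformal`) and `|∇w|²_S(σ⁻¹ z) = Ω(z)⁻² ‖∇v(z)‖²`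
(`innerDual_mvfderiv_roundMetric_extChartAt_symm`). Hence `w² G⁴ dV_g = v² dz` and
`G⁻² |∇w|²_g G⁴ dV_g = ‖∇v‖² dz` exactly, so both sphere integrals are the Euclidean integrals of
`v` and the Euclidean clause applied to `v` is the conclusion. The two sphere integrands are
continuous (they vanish near `p` with `w`, and `x ↦ 2/(1 − ⟪x,p⟫)` is continuous off `p`), which is
what the chart transport of Bochner integrals needs. Everything is proved; no definition, no named
fact.

References: J. M. Lee, T. H. Parker, *The Yamabe problem*, Bull. AMS 17 (1987), §3, (3.3)–(3.4)
(stereographic transport of `dV` and `|∇u|²`) [LeeParker1987]; T. Aubin, *Nonlinear Analysis on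
Manifolds* (1982), Ch. 6, §6.3 (conformal bookkeeping) [Aubin1982].
-/

noncomputable section

-- the registered namespace `Summit.SmoothPoincare4.SmoothPoincare4.Theorems` repeats a component
set_option linter.dupNamespace false

open scoped Manifold ContDiff Topology ENNReal NNReal ContinuousMap RealInnerProductSpace
open Set Filter MeasureTheory
open Literature.Geometry.Lorentzian Literature.Geometry.Riemannian

namespace Summit.SmoothPoincare4.SmoothPoincare4.Theorems

namespace SphereBlowupTransport

/-- A real function that vanishes near a point `p` and is continuous at every other point is
continuous. [folklore] -/
theorem continuous_of_eventuallyEq_zero {X : Type*} [TopologicalSpace X] {f : X → ℝ} {p : X}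
    (h0 : f =ᶠ[𝓝 p] 0) (h : ∀ x, x ≠ p → ContinuousAt f x) : Continuous f := by
  refine continuous_iff_continuousAt.2 fun x ↦ ?_
  by_cases hx : x = p
  · subst hx
    exact (continuousAt_congr h0).2 continuousAt_const
  · exact h x hx

/-- The target of Mathlib's stereographic chart of `S⁴` is all of `ℝ⁴`. [folklore] -/
theorem extChartAt_target_eq_univ [Fact (Module.finrank ℝ (EuclideanSpace ℝ (Fin 5)) = 4 + 1)]
    (q : Metric.sphere (0 : EuclideanSpace ℝ (Fin 5)) 1) :
    (extChartAt (𝓡 4) q).target = univ := by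
  -- adapted from Literature/Geometry/Riemannian/AubinYamabeSphereEuclidean.lean
  rw [extChartAt_target, ModelWithCorners.range_eq_univ, inter_univ,
    modelWithCornersSelf_coe_symm, preimage_id_eq, id]
  exact stereographic'_target (-q)

/-- **Chart transport for a conformally round metric.** If `g = W² g_S` on `S⁴` (`W` continuous)
then for every continuous `F` and every chart centre `q`,
`∫ F dV_g = ∫_{ℝ⁴} (4/(‖z‖²+4))⁴ W(σ⁻¹ z)⁴ F(σ⁻¹ z) dz`, `σ = extChartAt (𝓡 4) q`:
`dV_g = W⁴ dV_S` (`riemannianMeasure_eq_withDensity_of_conformal_sq_four`) and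
`dV_S = (4/(‖z‖²+4))⁴ dz` in the chart (`integral_roundMetric_eq_integral_chart`).
[cite: LeeParker1987, §3, (3.3)] -/
theorem integral_conformal_round_chart [Fact (Module.finrank ℝ (EuclideanSpace ℝ (Fin 5)) = 4 + 1)]
    (q : Metric.sphere (0 : EuclideanSpace ℝ (Fin 5)) 1)
    (g : PseudoRiemannianMetric (𝓡 4) ∞ (EuclideanSpace ℝ (Fin 4)) (TangentSpace (𝓡 4) :
      Metric.sphere (0 : EuclideanSpace ℝ (Fin 5)) 1 → Type _)) (hg : g.IsRiemannian)
    {W : Metric.sphere (0 : EuclideanSpace ℝ (Fin 5)) 1 → ℝ} (hWc : Continuous W)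
    (hgval : ∀ (x : Metric.sphere (0 : EuclideanSpace ℝ (Fin 5)) 1) (v w : TangentSpace (𝓡 4) x),
      g.val x v w = W x ^ 2 * (@roundMetric (EuclideanSpace ℝ (Fin 5)) _ _ 4 _).val x v w)
    {F : Metric.sphere (0 : EuclideanSpace ℝ (Fin 5)) 1 → ℝ} (hF : Continuous F) :
    ∫ x, F x ∂(riemannianMeasure (g.toContMDiffRiemannianMetric hg)) =
      ∫ z : EuclideanSpace ℝ (Fin 4), (4 / (‖z‖ ^ 2 + 4)) ^ 4 *
        (W ((extChartAt (𝓡 4) q).symm z) ^ 4 * F ((extChartAt (𝓡 4) q).symm z)) := by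
  set μ : Measure (Metric.sphere (0 : EuclideanSpace ℝ (Fin 5)) 1) := riemannianMeasure
    ((@roundMetric (EuclideanSpace ℝ (Fin 5)) _ _ 4 _).toContMDiffRiemannianMetric
      isRiemannian_roundMetric) with hμ
  have hvol : riemannianMeasure (g.toContMDiffRiemannianMetric hg) =
      μ.withDensity fun x ↦ ENNReal.ofReal (W x ^ 4) :=
    riemannianMeasure_eq_withDensity_of_conformal_sq_four (g.toContMDiffRiemannianMetric hg)
      ((@roundMetric (EuclideanSpace ℝ (Fin 5)) _ _ 4 _).toContMDiffRiemannianMetric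
      isRiemannian_roundMetric) hWc.measurable fun x v w ↦ by
        rw [PseudoRiemannianMetric.toContMDiffRiemannianMetric_inner,
          PseudoRiemannianMetric.toContMDiffRiemannianMetric_inner, hgval]
  have hmeas : Measurable fun x ↦ ENNReal.ofReal (W x ^ 4) :=
    ENNReal.measurable_ofReal.comp (hWc.pow 4).measurable
  have hlt : ∀ᵐ x ∂μ, ENNReal.ofReal (W x ^ 4) < ⊤ := ae_of_all _ fun _ ↦ ENNReal.ofReal_lt_top
  have htoReal : ∀ x, (ENNReal.ofReal (W x ^ 4)).toReal = W x ^ 4 := fun x ↦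
    ENNReal.toReal_ofReal (by positivity)
  rw [hvol, integral_withDensity_eq_integral_toReal_smul hmeas hlt]
  simp only [htoReal, smul_eq_mul]
  exact (integral_roundMetric_eq_integral_chart (EuclideanSpace ℝ (Fin 5)) q (n := 4)
    ((hWc.pow 4).mul hF)).2

end SphereBlowupTransport

open SphereBlowupTransport in
/-- **Witness helper 9 — transport of the Euclidean `𝒲`-clause to the blown-up witness metric
`g = W² g_S` on `S⁴`** (registered stub `helper_sphereBlowupTransport` of line
`green-blowup-conformal-entropy`). With `G x = (2/(1 − ⟪x,p⟫))/W x` and `σ` the stereographic chart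
at `−p` (chart facts as hypotheses): if the Euclidean clause holds at level `L` for all
`v ∈ C_c^∞(ℝ⁴)`, then for every `τ > 0` and every smooth `w` on `S⁴` vanishing near `p` with
`∫ (4πτ)⁻² w² G⁴ dV_g = 1` one has `L ≤ ∫ [4τ G⁻²|∇w|²_g − w² log w² − 4w²](4πτ)⁻² G⁴ dV_g` — both
sphere integrals are EXACTLY the Euclidean integrals of `v = w ∘ σ⁻¹` (`dV_g = W⁴ Ω⁴ dz`,
`2/(1 − ⟪σ⁻¹z,p⟫) = Ω⁻¹`, `|∇w|²_g = W⁻² Ω⁻² ‖∇v‖²`, `Ω = 4/(‖z‖²+4)`).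
[cite: LeeParker1987, §3, (3.3)–(3.4)] -/
theorem helper_sphereBlowupTransport :
    ∀ [Fact (Module.finrank ℝ (EuclideanSpace ℝ (Fin 5)) = 4 + 1)] (p : Metric.sphere (0 :
      EuclideanSpace ℝ (Fin 5)) 1) [(@roundMetric (EuclideanSpace ℝ (Fin 5)) _ _ 4 _).HasLeviCivita]
      (g : PseudoRiemannianMetric (𝓡 4) ∞ (EuclideanSpace ℝ (Fin 4)) (TangentSpace (𝓡 4) :
      Metric.sphere (0 : EuclideanSpace ℝ (Fin 5)) 1 → Type _)) [g.HasLeviCivita] (hg :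
      g.IsRiemannian) (W : Metric.sphere (0 : EuclideanSpace ℝ (Fin 5)) 1 → ℝ), ContMDiff (𝓡 4) 𝓘(ℝ,
      ℝ) ∞ W → (∀ x, 0 < W x) → (∀ (x : Metric.sphere (0 : EuclideanSpace ℝ (Fin 5)) 1) (v w :
      TangentSpace (𝓡 4) x), g.val x v w = W x ^ 2 * (@roundMetric (EuclideanSpace ℝ (Fin 5)) _ _ 4
      _).val x v w) → (∀ z : EuclideanSpace ℝ (Fin 4), ⟪(((extChartAt (𝓡 4) (-p)).symm z :
      Metric.sphere (0 : EuclideanSpace ℝ (Fin 5)) 1) : EuclideanSpace ℝ (Fin 5)), (p :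
      EuclideanSpace ℝ (Fin 5))⟫ = -((4 - ‖z‖ ^ 2) / (4 + ‖z‖ ^ 2))) → (∀ x : Metric.sphere (0 :
      EuclideanSpace ℝ (Fin 5)) 1, x ≠ p → x ∈ (extChartAt (𝓡 4) (-p)).source) → ∀ (L : ℝ), (∀ τ :
      ℝ, 0 < τ → ∀ v : EuclideanSpace ℝ (Fin 4) → ℝ, ContDiff ℝ ∞ v → HasCompactSupport v → ∫ z, (4
      * Real.pi * τ) ^ (-(4 : ℝ) / 2) * (v z) ^ 2 = 1 → L ≤ ∫ z, (τ * (4 * ‖gradient v z‖ ^ 2) - (v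
      z) ^ 2 * Real.log ((v z) ^ 2) - 4 * (v z) ^ 2) * (4 * Real.pi * τ) ^ (-(4 : ℝ) / 2)) → ∀ τ :
      ℝ, 0 < τ → ∀ w : Metric.sphere (0 : EuclideanSpace ℝ (Fin 5)) 1 → ℝ, ContMDiff (𝓡 4) 𝓘(ℝ, ℝ) ∞
      w → w =ᶠ[𝓝 p] 0 → ∫ x, (4 * Real.pi * τ) ^ (-(4 : ℝ) / 2) * (w x) ^ 2 * ((2 / (1 - ⟪(x :
      EuclideanSpace ℝ (Fin 5)), (p : EuclideanSpace ℝ (Fin 5))⟫)) / W x) ^ 4 ∂(riemannianMeasure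
      (g.toContMDiffRiemannianMetric hg)) = 1 → L ≤ ∫ x, (4 * τ * ((((2 / (1 - ⟪(x : EuclideanSpace
      ℝ (Fin 5)), (p : EuclideanSpace ℝ (Fin 5))⟫)) / W x))⁻¹ ^ 2 * g.gradSq w x) - (w x) ^ 2 *
      Real.log ((w x) ^ 2) - 4 * (w x) ^ 2) * ((4 * Real.pi * τ) ^ (-(4 : ℝ) / 2) * ((2 / (1 - ⟪(x :
      EuclideanSpace ℝ (Fin 5)), (p : EuclideanSpace ℝ (Fin 5))⟫)) / W x) ^ 4) ∂(riemannianMeasure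
      (g.toContMDiffRiemannianMetric hg)) := by
  intro _ p _ g _ hg W hWs hWpos hgval hchart hsrc L hE τ hτ w hw hw0 hnorm
  set gS := @roundMetric (EuclideanSpace ℝ (Fin 5)) _ _ 4 _
  set σ := extChartAt (𝓡 4) (-p)
  have hwc : Continuous w := hw.continuous
  have hWc : Continuous W := hWs.continuous
  have htgt : σ.target = univ := extChartAt_target_eq_univ (-p)
  -- the Euclidean test function `v = w ∘ σ⁻¹`
  set v : EuclideanSpace ℝ (Fin 4) → ℝ := fun z ↦ w (σ.symm z)
  have hvz : ∀ z, w (σ.symm z) = v z := fun z ↦ rfl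
  have hvs : ContDiff ℝ ∞ v := by
    rw [← contMDiff_iff_contDiff]
    exact hw.comp (contMDiff_extChartAt_symm_sphere (EuclideanSpace ℝ (Fin 5)) (-p) ∞)
  have hp_not : p ∉ tsupport w := notMem_tsupport_iff_eventuallyEq.2 hw0
  have hsupp : tsupport w ⊆ σ.source := fun x hx ↦ hsrc x (by rintro rfl; exact hp_not hx)
  have hvcs : HasCompactSupport v := by
    refine HasCompactSupport.of_support_subset_isCompact
      ((isClosed_tsupport w).isCompact.image_of_continuousOn
        ((continuousOn_extChartAt (-p)).mono hsupp)) fun z hz ↦ ?_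
    exact ⟨σ.symm z, subset_tsupport w hz, σ.right_inv (by rw [htgt]; exact mem_univ z)⟩
  -- chart algebra: `1 - ⟪σ⁻¹ z, p⟫ = 8/(4+‖z‖²)`, so `G_S(σ⁻¹ z) = (‖z‖²+4)/4`
  have hGSsymm : ∀ z : EuclideanSpace ℝ (Fin 4),
      2 / (1 - ⟪((σ.symm z : Metric.sphere (0 : EuclideanSpace ℝ (Fin 5)) 1) :
        EuclideanSpace ℝ (Fin 5)), (p : EuclideanSpace ℝ (Fin 5))⟫) = (‖z‖ ^ 2 + 4) / 4 := by
    intro z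
    rw [hchart z]
    have h4 : (4 : ℝ) + ‖z‖ ^ 2 ≠ 0 := by positivity
    field_simp
    ring
  have h1sub : ∀ x : Metric.sphere (0 : EuclideanSpace ℝ (Fin 5)) 1, x ≠ p →
      1 - ⟪(x : EuclideanSpace ℝ (Fin 5)), (p : EuclideanSpace ℝ (Fin 5))⟫ =
        8 / (4 + ‖σ x‖ ^ 2) := by
    intro x hx
    have h := hchart (σ x)
    rw [σ.left_inv (hsrc x hx)] at h
    rw [h]
    have h4 : (4 : ℝ) + ‖σ x‖ ^ 2 ≠ 0 := by positivity
    field_simp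
    ring
  have h1sub_pos : ∀ x : Metric.sphere (0 : EuclideanSpace ℝ (Fin 5)) 1, x ≠ p →
      0 < 1 - ⟪(x : EuclideanSpace ℝ (Fin 5)), (p : EuclideanSpace ℝ (Fin 5))⟫ := fun x hx ↦ by
    rw [h1sub x hx]
    positivity
  have hGSat : ∀ x : Metric.sphere (0 : EuclideanSpace ℝ (Fin 5)) 1, x ≠ p →
      ContinuousAt (fun y : Metric.sphere (0 : EuclideanSpace ℝ (Fin 5)) 1 ↦
        2 / (1 - ⟪(y : EuclideanSpace ℝ (Fin 5)), (p : EuclideanSpace ℝ (Fin 5))⟫)) x :=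
    fun x hx ↦ continuousAt_const.div
      (continuous_const.sub (continuous_subtype_val.inner continuous_const)).continuousAt
      (h1sub_pos x hx).ne'
  -- gradient squares: `|∇w|²_g = W⁻² |∇w|²_S`, `|∇w|²_S (σ⁻¹ z) = (4/(‖z‖²+4))⁻² ‖∇v z‖²`
  have hgradg : ∀ x, g.gradSq w x = (W x ^ 2)⁻¹ * gS.gradSq w x := fun x ↦
    ConformalRealisation.gradSq_of_conformal gS g (φ := fun y ↦ W y ^ 2) hgval
      (pow_pos (hWpos x) 2).ne' w
  have hgradS : ∀ z : EuclideanSpace ℝ (Fin 4),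
      gS.gradSq w (σ.symm z) = ((4 / (‖z‖ ^ 2 + 4)) ^ 2)⁻¹ * ‖gradient v z‖ ^ 2 := fun z ↦
    innerDual_mvfderiv_roundMetric_extChartAt_symm (V := EuclideanSpace ℝ (Fin 5)) (n := 4) (-p) z
      (hw.mdifferentiableAt (by simp))
  have hGc : Continuous (g.gradSq w) := (contMDiff_gradSq g hw).continuous
  have hgrad0 : ∀ᶠ x in 𝓝 p, g.gradSq w x = 0 := by
    filter_upwards [hw0.eventually_nhds] with x hx
    exact PseudoRiemannianMetric.gradSq_eq_zero_of_mvfderiv_eq_zero g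
      (PseudoRiemannianMetric.mvfderiv_eq_zero_of_eventuallyEq_zero hx)
  -- the two sphere integrands, continuous
  set F₁ : Metric.sphere (0 : EuclideanSpace ℝ (Fin 5)) 1 → ℝ := fun x ↦
    (4 * Real.pi * τ) ^ (-(4 : ℝ) / 2) * (w x) ^ 2 *
    ((2 / (1 - ⟪(x : EuclideanSpace ℝ (Fin 5)), (p : EuclideanSpace ℝ (Fin 5))⟫)) / W x) ^ 4
    with hF₁
  set F₂ : Metric.sphere (0 : EuclideanSpace ℝ (Fin 5)) 1 → ℝ := fun x ↦ (4 * τ * ((((2 / (1 -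
    ⟪(x : EuclideanSpace ℝ (Fin 5)), (p : EuclideanSpace ℝ (Fin 5))⟫)) / W x))⁻¹ ^ 2 * g.gradSq w x)
    - (w x) ^ 2 * Real.log ((w x) ^ 2) - 4 * (w x) ^ 2) * ((4 * Real.pi * τ) ^ (-(4 : ℝ) / 2) *
    ((2 / (1 - ⟪(x : EuclideanSpace ℝ (Fin 5)), (p : EuclideanSpace ℝ (Fin 5))⟫)) / W x) ^ 4)
    with hF₂
  have hF₁c : Continuous F₁ := by
    refine continuous_of_eventuallyEq_zero (p := p) ?_ fun x hx ↦ ?_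
    · filter_upwards [hw0] with x hx
      simp [hF₁, hx]
    · exact (continuousAt_const.mul ((hwc.pow 2).continuousAt)).mul
        (((hGSat x hx).div hWc.continuousAt (hWpos x).ne').pow 4)
  have hF₂c : Continuous F₂ := by
    refine continuous_of_eventuallyEq_zero (p := p) ?_ fun x hx ↦ ?_
    · filter_upwards [hw0, hgrad0] with x hx hgx
      simp [hF₂, hx, hgx]
    · have hQ : ContinuousAt (fun y : Metric.sphere (0 : EuclideanSpace ℝ (Fin 5)) 1 ↦
          (2 / (1 - ⟪(y : EuclideanSpace ℝ (Fin 5)), (p : EuclideanSpace ℝ (Fin 5))⟫)) / W y) x :=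
        (hGSat x hx).div hWc.continuousAt (hWpos x).ne'
      have hQne : (2 / (1 - ⟪(x : EuclideanSpace ℝ (Fin 5)), (p : EuclideanSpace ℝ (Fin 5))⟫)) / W x
          ≠ 0 := div_ne_zero (div_ne_zero two_ne_zero (h1sub_pos x hx).ne') (hWpos x).ne'
      exact ((((continuousAt_const.mul (((hQ.inv₀ hQne).pow 2).mul hGc.continuousAt)).sub
        ((Real.continuous_mul_log.comp (hwc.pow 2)).continuousAt)).sub
        (continuousAt_const.mul ((hwc.pow 2).continuousAt))).mul
        (continuousAt_const.mul (hQ.pow 4)))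
  -- transport of the normalisation
  have hT : ∀ {F : Metric.sphere (0 : EuclideanSpace ℝ (Fin 5)) 1 → ℝ}, Continuous F →
      ∫ x, F x ∂(riemannianMeasure (g.toContMDiffRiemannianMetric hg)) =
        ∫ z : EuclideanSpace ℝ (Fin 4), (4 / (‖z‖ ^ 2 + 4)) ^ 4 *
          (W (σ.symm z) ^ 4 * F (σ.symm z)) :=
    fun hF ↦ integral_conformal_round_chart (-p) g hg hWc hgval hF
  have hnormE : ∫ z, (4 * Real.pi * τ) ^ (-(4 : ℝ) / 2) * (v z) ^ 2 = 1 := by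
    refine Eq.trans ?_ hnorm
    rw [hT hF₁c]
    refine integral_congr_ae (ae_of_all _ fun z ↦ ?_)
    simp only [hF₁, hGSsymm z, hvz]
    have hW := (hWpos (σ.symm z)).ne'
    have h4 : ‖z‖ ^ 2 + 4 ≠ 0 := by positivity
    field_simp
  -- the Euclidean clause for `v`, transported back
  have key := hE τ hτ v hvs hvcs hnormE
  refine key.trans_eq ?_
  rw [hT hF₂c]
  refine integral_congr_ae (ae_of_all _ fun z ↦ ?_)
  simp only [hF₂, hGSsymm z, hgradg, hgradS z, hvz]
  have hW := (hWpos (σ.symm z)).ne'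
  have h4 : ‖z‖ ^ 2 + 4 ≠ 0 := by positivity
  field_simp

end Summit.SmoothPoincare4.SmoothPoincare4.Theorems

end
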